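import Summits.Ventures.CertifiedManyBodySolver.Rows.AndersonHalfFilledBlock
import Summits.HubbardSuperconductivity.ManyBodyBootstrap.Bounds.AndersonRowsChain14Mcert

/-!
# Template: a lane-A claim node from ONE block (row #277, `ℓ = 14`, `U = 8`)

Support file for the certified many-body solver (venture `CertifiedManyBodySolver`, lane A rows):
first certified bounds; not a superconductivity verdict; every number certified or labelled float.

Worked instance of the half-filled block lemma (`AndersonHalfFilledBlock`) on the CERTIFIED row of
record `sr-mbsolver-m1-2:anderson_chain_l14_opt_U8_mcert` (#277, claim node
`anderson_psd_chain_l14_opt_U8` of `Bounds/AndersonRowsChain14Mcert.lean`): the full-Fock-space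
node (`4¹⁴ = 268 435 456` configurations, 225 `(N↑, N↓)` blocks) follows from positive
semidefiniteness of the single half-filled block `N = 14` (`C(28,14) = 40 116 600` rows), or of the
single `(N↑, N↓) = (7, 7)` block (`C(14,7)² = 11 778 624` rows, the binding block of the certificate
of record). The two theorems are the pattern for the `ℓ = 16, 17` rows: replace `14`, the weights
and `q`; the side conditions are `0 ≤ U` (`norm_num`) and entrywise nonnegative site weights
(`v_…_nonneg`, by `interval_cases`). Nothing here is a new certificate: the hypotheses are the
(weaker) block statements, to be discharged by an exact witness exactly as the full node is today.

References: E. H. Lieb, Phys. Rev. Lett. **62** (1989) 1201, Theorems 1–2.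
-/

/-! ## Demo / template: the ℓ = 14 row of record (`AndersonRowsChain14Mcert`, CERTIFIED #277) -/

namespace Summit.Ventures.CertifiedManyBodySolver.Rows

open Matrix Finset Literature.MathematicalPhysics.QuantumLattice
  Literature.MathematicalPhysics.QuantumLattice.AndersonCluster Literature.Probability.LatticeModels
  Summit.HubbardSuperconductivity.ManyBodyBootstrap.Bounds
open scoped ComplexOrder

/-- The site weights of row #277 are entrywise nonnegative.
[computation: 14 dyadic rationals ≥ 0] -/
theorem v_chain_l14_opt_U8_nonneg (j : ℕ) : 0 ≤ v_chain_l14_opt_U8 j := by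
  unfold v_chain_l14_opt_U8
  rcases lt_or_ge j 14 with hj | hj
  · interval_cases j <;> norm_num
  · rw [List.getD_eq_default _ _ (by simpa using hj)]

/-- **Row #277's claim node from its half-filled block**: PSD of the `N = 14` block of
`h(w,v) - q·1` (`q = -824181/2500000`) already gives the full-Fock-space claim node
`anderson_psd_chain_l14_opt_U8`. [cite: LiebPRL1989, Theorem 2 and its proof] -/
theorem anderson_psd_chain_l14_opt_U8_of_halfFilled_block
    (h : ((andersonCluster (halfOpenBox 1 14) 1 8 (chainBondWeights w_chain_l14_opt_U8)
        (chainSiteWeights v_chain_l14_opt_U8)).toBlock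
        (fun s => s.card = 14) (fun s => s.card = 14) -
        (((-824181/2500000 : ℚ) : ℝ) : ℂ) • 1).PosSemidef) :
    anderson_psd_chain_l14_opt_U8 :=
  posSemidef_andersonChain_sub_smul_of_halfFilled_block 14 1 (by norm_num) _
    v_chain_l14_opt_U8_nonneg h

/-- **Row #277's claim node from its `(N↑, N↓) = (7, 7)` block** (the binding block of the
certificate of record): PSD of that single block of `h(w,v) - q·1` gives
`anderson_psd_chain_l14_opt_U8`. [cite: LiebPRL1989, proof of Theorems 1 and 2] -/
theorem anderson_psd_chain_l14_opt_U8_of_sector_block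
    (h : ((andersonCluster (halfOpenBox 1 14) 1 8 (chainBondWeights w_chain_l14_opt_U8)
        (chainSiteWeights v_chain_l14_opt_U8)).toBlock
        (fun s => (upPart s).card = 7 ∧ (downPart s).card = 7)
        (fun s => (upPart s).card = 7 ∧ (downPart s).card = 7) -
        (((-824181/2500000 : ℚ) : ℝ) : ℂ) • 1).PosSemidef) :
    anderson_psd_chain_l14_opt_U8 :=
  posSemidef_andersonChain_sub_smul_of_sector_block 14 1 (by norm_num) _
    v_chain_l14_opt_U8_nonneg rfl (by norm_num) (by norm_num) h

end Summit.Ventures.CertifiedManyBodySolver.Rows
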